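import Literature.Geometry.Riemannian.MeanConvexLevelSetFlow
import Literature.Geometry.Lorentzian.CauchyDevelopmentComap
import Literature.Geometry.Riemannian.RicciFlowScalarCurvatureProofs
import HarnessLib

/-!
# Reparametrisation invariance of the mean curvature and of classical mean curvature flows

Topic `Literature/Geometry/Riemannian`. The tree's classical mean curvature flows
(`Literature.Geometry.Riemannian.IsClassicalMCF`, `MeanConvexLevelSetFlow.lean`) are families of
maps `F t : N → M` of a fixed compact parameter manifold `N`; the moving hypersurface is
`S(t) = F t (N)`. This file proves that the notion does not depend on the parametrisation:
for a diffeomorphism `e : N' ≃ₘ N` of `C^∞` manifolds modelled on `ℝⁿ`, the reparametrised family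
`t ↦ F t ∘ e` with the fields `ν t ∘ e` is again a classical mean curvature flow
(`IsClassicalMCF.comp_diffeomorph`), with the same hypersurfaces `S(t)`.

The only non-formal point is the **invariance of the mean curvature under reparametrisation**,
`H_{f ∘ e, ν ∘ e}(y) = H_{f, ν}(e y)` (`meanCurvature_comp_diffeomorph`): the induced metric of
`f ∘ e` is the pullback by `de_y` of that of `f` (`inducedBilin_comp_right`), the second
fundamental form likewise (`secondFundamentalForm_comp_right`, `CauchyDevelopmentComap.lean`,
O'Neill 1983, Ch. 4, Lemma 4.4: the shape tensor is a tensor on the submanifold), so a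
`(f ∘ e)^* g`-orthonormal basis of `T_y N'` is carried by `de_y` to an `f^* g`-orthonormal basis of
`T_{e y} N`, and the metric traces (`trace_eq_sum_of_isOrthonormalFrame`) agree term by term.
Everything is proved; no named facts.

## Contents

* `inducedBilin_comp_right` — `(f ∘ e)^* g (u, w) = f^* g (de u, de w)`;
* `IsSpacelikeImmersion.comp_diffeomorph`, `IsUnitNormal.comp_right` — immersions and unit
  normals reparametrise;
* `meanCurvature_comp_diffeomorph` — `H_{f ∘ e, ν ∘ e} = H_{f, ν} ∘ e`;
* `IsClassicalMCF.comp_diffeomorph` — classical mean curvature flows reparametrise (with the same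
  slices, `range (F t ∘ e) = range (F t)` by `e.surjective.range_comp`).

## References

* B. O'Neill, *Semi-Riemannian geometry* (1983), Ch. 4, Lemma 4.4 ff. (the shape tensor), p. 97
  (the induced metric). [ONeill1983]
* G. Huisken, *Flow by mean curvature of convex surfaces into spheres*, J. Differential Geom. 20
  (1984), §1 (the flow of immersions `F(·, t)`; invariance under tangential reparametrisation).
-/

noncomputable section

open Bundle Set Function Manifold
open scoped Manifold ContDiff Topology

namespace Literature.Geometry.Riemannian

open Literature.Geometry.Lorentzian
open Literature.Geometry.Lorentzian.PseudoRiemannianMetric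

universe u

variable {n : ℕ} {M : Type u} [TopologicalSpace M] [ChartedSpace (EuclideanSpace ℝ (Fin (n + 1))) M]
  [IsManifold (𝓡 (n + 1)) ∞ M]
  {g : PseudoRiemannianMetric (𝓡 (n + 1)) ∞ (EuclideanSpace ℝ (Fin (n + 1)))
    (TangentSpace (𝓡 (n + 1)) : M → Type _)}
  {N : Type*} [TopologicalSpace N] [ChartedSpace (EuclideanSpace ℝ (Fin n)) N]
  [IsManifold (𝓡 n) ∞ N]
  {N' : Type*} [TopologicalSpace N'] [ChartedSpace (EuclideanSpace ℝ (Fin n)) N']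
  [IsManifold (𝓡 n) ∞ N']

/-! ### The induced metric, immersions and unit normals under reparametrisation -/

omit [IsManifold (𝓡 n) ∞ N] [IsManifold (𝓡 n) ∞ N'] in
/-- **`(f ∘ e)^* g = e^* (f^* g)` pointwise**: `g(d(f ∘ e) u, d(f ∘ e) w) = g(df (de u), df (de w))`
(the chain rule). O'Neill 1983, Ch. 4, p. 97. [cite: ONeill1983, Ch. 4, p. 97] -/
theorem _root_.Literature.Geometry.Lorentzian.PseudoRiemannianMetric.inducedBilin_comp_right
    {f : N → M} {e : N' → N} {y : N'}
    (hf : MDifferentiableAt (𝓡 n) (𝓡 (n + 1)) f (e y)) (he : MDifferentiableAt (𝓡 n) (𝓡 n) e y)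
    (u w : TangentSpace (𝓡 n) y) :
    g.inducedBilin (𝓡 n) (f ∘ e) y u w =
      g.inducedBilin (𝓡 n) f (e y) (mfderiv (𝓡 n) (𝓡 n) e y u) (mfderiv (𝓡 n) (𝓡 n) e y w) := by
  rw [inducedBilin_apply, inducedBilin_apply, mfderiv_comp y hf he]
  rfl

omit [IsManifold (𝓡 (n + 1)) ∞ M] [IsManifold (𝓡 n) ∞ N] [IsManifold (𝓡 n) ∞ N'] in
/-- The differential of `f ∘ e` is `df ∘ de` (chain rule, applied form). [folklore] -/
theorem mfderiv_comp_right_apply {f : N → M} {e : N' → N} {y : N'}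
    (hf : MDifferentiableAt (𝓡 n) (𝓡 (n + 1)) f (e y)) (he : MDifferentiableAt (𝓡 n) (𝓡 n) e y)
    (u : TangentSpace (𝓡 n) y) :
    mfderiv (𝓡 n) (𝓡 (n + 1)) (f ∘ e) y u =
      mfderiv (𝓡 n) (𝓡 (n + 1)) f (e y) (mfderiv (𝓡 n) (𝓡 n) e y u) := by
  rw [mfderiv_comp y hf he]
  rfl

omit [IsManifold (𝓡 n) ∞ N] [IsManifold (𝓡 n) ∞ N'] in
/-- The differential of a diffeomorphism kills no non-zero vector. [folklore] -/
theorem mfderiv_diffeomorph_apply_ne_zero (e : N' ≃ₘ⟮𝓡 n, 𝓡 n⟯ N) (y : N')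
    {v : TangentSpace (𝓡 n) y} (hv : v ≠ 0) : mfderiv (𝓡 n) (𝓡 n) e y v ≠ 0 := by
  intro h
  set L : TangentSpace (𝓡 n) y ≃L[ℝ] TangentSpace (𝓡 n) (e y) :=
    e.mfderivToContinuousLinearEquiv (by simp) y with hL
  have hLv : L v = mfderiv (𝓡 n) (𝓡 n) e y v := by rw [hL]; rfl
  refine hv (L.injective ?_)
  rw [map_zero, hLv]
  exact h

omit [IsManifold (𝓡 n) ∞ N] [IsManifold (𝓡 n) ∞ N'] in
/-- **A spacelike immersion reparametrised by a diffeomorphism is a spacelike immersion**: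
`(f ∘ e)^* g (v, v) = f^* g (de v, de v) > 0` for `v ≠ 0`, `de` being injective.
O'Neill 1983, Ch. 4, p. 97. [cite: ONeill1983, Ch. 4, p. 97] -/
theorem _root_.Literature.Geometry.Lorentzian.PseudoRiemannianMetric.IsSpacelikeImmersion.comp_diffeomorph
    {f : N → M}
    (hf : g.IsSpacelikeImmersion (𝓡 n) f) (e : N' ≃ₘ⟮𝓡 n, 𝓡 n⟯ N) :
    g.IsSpacelikeImmersion (𝓡 n) (f ∘ e) := by
  have he : ContMDiff (𝓡 n) (𝓡 n) (∞ + 1) e := e.contMDiff.of_le (by simp)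
  refine ⟨hf.contMDiff.comp he, fun y v hv ↦ ?_⟩
  have hfd : MDifferentiableAt (𝓡 n) (𝓡 (n + 1)) f (e y) :=
    (hf.contMDiff (e y)).mdifferentiableAt (by simp)
  have hed : MDifferentiableAt (𝓡 n) (𝓡 n) e y := (e.contMDiff y).mdifferentiableAt (by simp)
  rw [inducedBilin_comp_right hfd hed]
  exact hf.inducedBilin_pos (e y) (mfderiv_diffeomorph_apply_ne_zero e y hv)

omit [IsManifold (𝓡 n) ∞ N] [IsManifold (𝓡 n) ∞ N'] in
/-- **A unit normal reparametrises**: `ν ∘ e` is a unit normal of sign `ε` along `f ∘ e` if `ν` is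
one along `f` (`g(ν, d(f ∘ e) v) = g(ν, df (de v)) = 0`). O'Neill 1983, Ch. 4, p. 98.
[cite: ONeill1983, Ch. 4, p. 98] -/
theorem _root_.Literature.Geometry.Lorentzian.PseudoRiemannianMetric.IsUnitNormal.comp_right
    {f : N → M} {ν : NormalField (𝓡 (n + 1)) f} {ε : ℝ} (hν : g.IsUnitNormal (𝓡 n) f ν ε)
    {e : N' → N}
    (hf : ∀ x, MDifferentiableAt (𝓡 n) (𝓡 (n + 1)) f x)
    (he : ∀ y, MDifferentiableAt (𝓡 n) (𝓡 n) e y) :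
    g.IsUnitNormal (𝓡 n) (f ∘ e) (fun y ↦ ν (e y)) ε := by
  refine ⟨fun y v ↦ ?_, fun y ↦ hν.2 (e y)⟩
  have h := hν.1 (e y) (mfderiv (𝓡 n) (𝓡 n) e y v)
  rw [← mfderiv_comp_right_apply (hf (e y)) (he y)] at h
  exact h

/-! ### The mean curvature under reparametrisation -/

section MeanCurvature

variable [g.HasLeviCivita]

/-- **Invariance of the mean curvature under reparametrisation**: for a spacelike immersion
`f : N → M` with a field `ν` along it whose lift to `TM` is differentiable, and a diffeomorphism
`e : N' ≃ₘ N`, `H_{f ∘ e, ν ∘ e}(y) = H_{f, ν}(e y)`. The induced metric and the second fundamental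
form of `f ∘ e` at `y` are the pullbacks by the linear isomorphism `de_y` of those of `f` at `e y`
(`inducedBilin_comp_right`, `secondFundamentalForm_comp_right`), so `de_y` carries an orthonormal
basis for the former to one for the latter and the traces `Σᵢ K(bᵢ, bᵢ)` agree. O'Neill 1983,
Ch. 4, Lemma 4.4 ff. (the shape operator and its trace are tensorial on the submanifold); Huisken
1984, §1. [cite: ONeill1983, Ch. 4, Lemma 4.4] -/
theorem _root_.Literature.Geometry.Lorentzian.PseudoRiemannianMetric.meanCurvature_comp_diffeomorph
    {f : N → M}
    (hpb : contMDiff_pullbackBilin (𝓡 (n + 1)) M (𝓡 n) N ∞)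
    (hpb' : contMDiff_pullbackBilin (𝓡 (n + 1)) M (𝓡 n) N' ∞)
    (hf : g.IsSpacelikeImmersion (𝓡 n) f) (e : N' ≃ₘ⟮𝓡 n, 𝓡 n⟯ N)
    (hf' : g.IsSpacelikeImmersion (𝓡 n) (f ∘ e)) {ν : NormalField (𝓡 (n + 1)) f} (y : N')
    (hν : MDifferentiableAt (𝓡 n) (𝓡 (n + 1)).tangent
      (fun x ↦ (TotalSpace.mk' (EuclideanSpace ℝ (Fin (n + 1))) (f x) (ν x) :
        TangentBundle (𝓡 (n + 1)) M)) (e y)) :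
    g.meanCurvature (f ∘ e) hpb' hf' (fun y ↦ ν (e y)) y = g.meanCurvature f hpb hf ν (e y) := by
  -- the differential of `e` at `y` as a linear isomorphism `L : T_y N' ≃ T_{e y} N`
  set L : TangentSpace (𝓡 n) y ≃L[ℝ] TangentSpace (𝓡 n) (e y) :=
    e.mfderivToContinuousLinearEquiv (by simp) y with hL
  have hLe : ∀ u, L u = mfderiv (𝓡 n) (𝓡 n) e y u := fun u ↦ by rw [hL]; rfl
  have hfd : MDifferentiableAt (𝓡 n) (𝓡 (n + 1)) f (e y) :=
    (hf.contMDiff (e y)).mdifferentiableAt (by simp)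
  have hed : MDifferentiableAt (𝓡 n) (𝓡 n) e y := (e.contMDiff y).mdifferentiableAt (by simp)
  -- the two induced metrics
  set g₁ := g.inducedMetric f hpb hf with hg₁
  set g₂ := g.inducedMetric (f ∘ e) hpb' hf' with hg₂
  have hval : ∀ u w : TangentSpace (𝓡 n) y, g₂.val y u w = g₁.val (e y) (L u) (L w) := fun u w ↦ by
    rw [hg₁, hg₂, inducedMetric_val, inducedMetric_val, inducedBilin_comp_right hfd hed, hLe, hLe]
  -- an orthonormal basis of `T_{e y} N` for `f^* g`, pulled back by `L`
  have hpos : ∀ u : TangentSpace (𝓡 n) (e y), u ≠ 0 → 0 < g₁.val (e y) u u :=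
    fun u hu ↦ isRiemannian_inducedMetric _ _ hpb hf (e y) u hu
  obtain ⟨b, hb⟩ := g₁.exists_basis_isOrthonormalFrame hpos (m := n) finrank_euclideanSpace_fin
  set b' : Module.Basis (Fin n) ℝ (TangentSpace (𝓡 n) y) := b.map L.symm.toLinearEquiv with hb'def
  have hb'L : ∀ i, L (b' i) = b i := fun i ↦ by
    rw [hb'def, Module.Basis.map_apply]
    exact L.apply_symm_apply (b i)
  have hb' : g₂.IsOrthonormalFrame y b' :=
    ⟨fun i ↦ by rw [hval, hb'L]; exact hb.1 i,
      fun i j hij ↦ by rw [hval, hb'L, hb'L]; exact hb.2 i j hij⟩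
  rw [meanCurvature, meanCurvature, ← hg₁, ← hg₂, g₂.trace_eq_sum_of_isOrthonormalFrame b' hb',
    g₁.trace_eq_sum_of_isOrthonormalFrame b hb]
  refine Finset.sum_congr rfl fun i _ ↦ ?_
  rw [secondFundamentalForm_comp_right g BoundarylessManifold.isInteriorPoint
    BoundarylessManifold.isInteriorPoint hν hed (b' i) (b' i), ← hLe, hb'L]

end MeanCurvature

/-! ### Classical mean curvature flows under reparametrisation -/

section Flow

variable [g.HasLeviCivita]

/-- **Classical mean curvature flows reparametrise**: if `(F, ν)` is a classical mean curvature
flow of closed hypersurfaces on `[a, b]` parametrised over `N` and `e : N' ≃ₘ N` is a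
diffeomorphism, then `(t ↦ F t ∘ e, t ↦ ν t ∘ e)` is a classical mean curvature flow parametrised
over `N'`: joint smoothness, the immersion, embedding and unit-normal conditions compose with `e`,
and the flow equation at `y ∈ N'` is the flow equation at `e y`, the mean curvature being
invariant under reparametrisation (`meanCurvature_comp_diffeomorph`). Huisken 1984, §1 (the flow
of immersions `F(·, t) : M → ℝⁿ⁺¹`; tangential reparametrisations do not change the moving
hypersurface). [cite: Huisken1984, §1] -/
theorem IsClassicalMCF.comp_diffeomorph {F : ℝ → N → M}
    {ν : (t : ℝ) → NormalField (𝓡 (n + 1)) (F t)} {a b : ℝ}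
    (h : IsClassicalMCF g F ν a b) (e : N' ≃ₘ⟮𝓡 n, 𝓡 n⟯ N) :
    IsClassicalMCF g (fun t ↦ F t ∘ e) (fun t y ↦ ν t (e y)) a b := by
  haveI := h.compactSpace
  obtain ⟨U, hU, hIU, hF⟩ := h.contMDiffOn
  have hsp : ∀ t ∈ Icc a b, g.IsSpacelikeImmersion (𝓡 n) (F t ∘ e) :=
    fun t ht ↦ (h.isSpacelikeImmersion t ht).comp_diffeomorph e
  have hed : ∀ y, MDifferentiableAt (𝓡 n) (𝓡 n) e y :=
    fun y ↦ (e.contMDiff y).mdifferentiableAt (by simp)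
  have hFd : ∀ t ∈ Icc a b, ∀ x, MDifferentiableAt (𝓡 n) (𝓡 (n + 1)) (F t) x :=
    fun t ht x ↦ ((h.isSpacelikeImmersion t ht).contMDiff x).mdifferentiableAt (by simp)
  refine
    { compactSpace := e.toHomeomorph.symm.compactSpace
      contMDiffOn := ⟨U, hU, hIU, ?_⟩
      isSpacelikeImmersion := hsp
      injective := fun t ht y₁ y₂ hy ↦ e.injective (h.injective t ht hy)
      isUnitNormal := fun t ht ↦ (h.isUnitNormal t ht).comp_right (hFd t ht) hed
      contMDiff_normal := fun t ht ↦ (h.contMDiff_normal t ht).comp e.contMDiff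
      velocity_eq := fun t ht y ↦ ?_ }
  · -- joint smoothness: `(t, y) ↦ F t (e y)` is `F ∘ (id × e)`
    have hP : ContMDiff (𝓘(ℝ, ℝ).prod (𝓡 n)) (𝓘(ℝ, ℝ).prod (𝓡 n)) ∞
        (fun p : ℝ × N' ↦ (p.1, e p.2)) :=
      contMDiff_fst.prodMk (e.contMDiff.comp contMDiff_snd)
    exact hF.comp hP.contMDiffOn fun p hp ↦ ⟨hp.1, mem_univ _⟩
  · -- the flow equation at `y` is the flow equation at `e y`
    have hν : MDifferentiableAt (𝓡 n) (𝓡 (n + 1)).tangent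
        (fun x ↦ (TotalSpace.mk' (EuclideanSpace ℝ (Fin (n + 1))) (F t x) (ν t x) :
          TangentBundle (𝓡 (n + 1)) M)) (e y) :=
      (h.contMDiff_normal t ht (e y)).mdifferentiableAt (by simp)
    rw [meanCurvature_comp_diffeomorph contMDiff_pullbackBilin_holds contMDiff_pullbackBilin_holds
      (h.isSpacelikeImmersion t ht) e (hsp t ht) y hν]
    exact h.velocity_eq t ht (e y)

end Flow

end Literature.Geometry.Riemannian

end
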